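import Literature.AlgebraicGeometry.GroupSchemes.HopfIdealOfClosedSubgroup            -- ★ `Alg`, `quotIncl`, `isHopfIdeal_ker_appTop`, `ker_appTop_quotIncl`, `exists_grpObj_isMonHom_quotIncl`
import Literature.AlgebraicGeometry.GroupSchemes.BTGroupFrobeniusKernelInCoordinates   -- ★ §4 `map_ker_appTop_kerι_relFrobeniusOver_le`, `ker_appTop_kerι_relFrobeniusOver_le_comap`
import Literature.AlgebraicGeometry.GroupSchemes.AffineGroupSchemeOfHopfAlgebra        -- ★ `Alg.comap`, `Alg.comap_apply`, `Alg.comap_id`, `Alg.comap_comp`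
import Mathlib.AlgebraicGeometry.Morphisms.Etale
import HarnessLib

/-!
# Transport of admissible Hopf ideals along an isomorphism of affine group schemes

Topic `Literature/AlgebraicGeometry/GroupSchemes`; namespace `Literature.AlgebraicGeometry.GroupSchemes.AdmIdealTransport`.  THEOREMS ONLY
(no definition, no instance, no notation, no named fact, no `sorry`).  Cell `hodgecm-mathlib` (D-0151), programme P6 «MOD» (crux hLiu418 =
stmt-HodgeConjecture-24832, `--supports`, count-neutral): organ **«TWIST-IDEAL»** — the GENERIC half of the D10 TWIST binders of the
DICT-constructor head `heart_of_constructors` (`Cruxes/HLiu418/Lines/F0_P6c_DictConstructors.lean`, desk F0P6c-plan (g2), cand v3 4877e98f: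
`smapI` ∕ `hsmapAdm` ∕ `hsmapF`) and of the P6a `ModuliDatum` fields `smap` ∕ `smap_kerF` ∕ `isEtale_smap_iff` (desk F0P6a-plan (g0), Defs v0.2):
CONSTRUCTOR-SKELETON v0 §2 row `hsp` «TWIST (κ̄-isomorphisms preserve étaleness and Frobenius kernels)».  HC_CM is proved only modulo the
printed citations until rung 0 closes; this file is generic and changes no count.

THE PRINT.  [Waterhouse1979] §2.1 ∕ [GortzWedhorn2023] (27.1.1), §(27.2): for an AFFINE group scheme `G = Spec A` over a ring `R`, closed subgroup
schemes `H ↪ G` ↔ Hopf ideals `I = I(H) ⊂ A` (★ `isHopfIdeal_ker_appTop`, ★ `exists_grpObj_isMonHom_quotIncl`, ★ `ker_appTop_quotIncl`).  An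
ISOMORPHISM of group schemes `φ : G ⥲ G'` carries `H` to the closed subgroup scheme `φ(H) ↪ G'`, whose ideal is
`{a' ∈ A' ∣ Γ(φ)(a') ∈ I} = Γ(φ)⁻¹(I)` (`Ideal.comap Γ(φ) I`; `= Γ(φ⁻¹)(I)`), and `A' ⧸ Γ(φ)⁻¹(I) ≅ A ⧸ I` along `Γ(φ)`; so every invariant of
`H` read on `I` is an invariant of `φ(H)` read on `Γ(φ)⁻¹(I)`: the order (`rank_R A⧸I`, [Tate1997FiniteFlatGroupSchemes] (3.7)), étaleness of
`Spec (A ⧸ I) → Spec R`, stability under a family of endomorphisms `β a` intertwined by `φ` (`β a ≫ φ = φ ≫ β' a`), and — by functoriality of the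
relative Frobenius `F^n_{G∕k}` in homomorphisms ([SGA3I] VII_A 4.1; ★ `map_ker_appTop_kerι_relFrobeniusOver_le` for `φ` AND `φ⁻¹`) — being the
Frobenius kernel: `φ(Ker F^n_G) = Ker F^n_{G'}`.  In the application (P6 HEART, D10): `G = 𝒢_x̄[ϖ]`, `G' = 𝒢_{θ(γ,1)_s x̄}[ϖ]`, `φ` the
`[ϖ]`-layer of the fibre isomorphism `𝒜_x̄ ≅ 𝒜_{θ(γ,1)_s x̄}` given by the `θ`-equivariant structure on the universal abelian scheme, `β = β'`
the `𝒪_F`-action; `smapI γ x̄ := Ideal.comap Γ(φ)`.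

## Contents (`φ : G ≅ G'` in `SchemeOver R`, `G G'` affine; §5 over a field `k` of exponential characteristic `p`)
* §1 THE ALGEBRA ISOMORPHISM `Γ(φ)`: `appTop_inv_appTop_hom_apply` ∕ `appTop_hom_appTop_inv_apply` (two-sided inverse on elements),
  `exists_algEquiv_of_iso` (`Alg G' ≃ₐ[R] Alg G` that IS `Γ(φ)`, inverse `Γ(φ⁻¹)`), `comap_appTop_eq_map_appTop_inv`
  (`Γ(φ)⁻¹(I) = Γ(φ⁻¹)(I)`), functoriality `comap_appTop_comp` ∕ `comap_appTop_id` ∕ `comap_appTop_inv_comap_appTop_hom` (so `I ↦ Γ(φ_γ)⁻¹ I`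
  is an action of the twisting group, bijective on ideals);
* §2 HOPF: **`isHopfIdeal_comap_appTop`** — `I` Hopf ⇒ `Γ(φ)⁻¹(I)` Hopf (`= ker Γ(quotIncl G I ≫ φ)`, the ideal of a closed subgroup of `G'`);
* §3 ORDER: `exists_algEquiv_quotient_comap_appTop` (`Alg G' ⧸ Γ(φ)⁻¹ I ≃ₐ[R] Alg G ⧸ I`), **`finrank_quotient_comap_appTop`**;
* §4 STABILITY: **`map_le_comap_appTop_of_comm`** (any morphism `φ`, no group structure: `β ≫ φ = φ ≫ β'`, `Γ(β) I ≤ I ⇒ Γ(β') (Γ(φ)⁻¹ I) ≤ Γ(φ)⁻¹ I`);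
  the ADMISSIBLE TRIPLE transports: **`isHopfIdeal_and_finrank_and_map_le_comap_appTop`** (= `hsmapAdm` with `IsAdm` unfolded);
* §5 FROBENIUS KERNEL: **`comap_appTop_ker_kerι_relFrobeniusOver`** (`Γ(φ)⁻¹ (ker Γ(ι_{Ker F^n_G})) = ker Γ(ι_{Ker F^n_{G'}})` = `hsmapF` with
  `kerFI` unfolded) and its `map` form;
* §6 ÉTALENESS: **`etale_specOver_quotient_comap_appTop_iff`** (`Spec (Alg G' ⧸ Γ(φ)⁻¹ I) → Spec k` étale ↔ `Spec (Alg G ⧸ I) → Spec k` étale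
  = `isEtale_smap_iff` with `IdealIsEtale` unfolded; any ring `R`).

## References
* [Waterhouse1979] W. C. Waterhouse, *Introduction to Affine Group Schemes*, GTM 66 (1979) — §2.1 (closed subgroups and Hopf ideals).
* [GortzWedhorn2023] U. Görtz, T. Wedhorn, *Algebraic Geometry II* (2023) — (27.1.1), §(27.2) (27.2.1), p. 607.
* [GortzWedhorn2020] U. Görtz, T. Wedhorn, *Algebraic Geometry I* (2nd ed. 2020) — Definition 4.45 (2) (p. 117) (Frobenius), (4.7).
* [SGA3I] M. Demazure, A. Grothendieck (eds.), *SGA 3, Tome I*, Exp. VII_A §4, 4.1 (relative Frobenius of a group scheme; functoriality).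
* [Tate1997FiniteFlatGroupSchemes] J. Tate, *Finite flat group schemes*, in: Modular Forms and Fermat's Last Theorem (1997) — (3.7).
-/

set_option autoImplicit false

-- Mathlib's `Over`/`Scheme` APIs and the transported group structure on the twist are stated across semireducible wrappers
-- (as in ★ `GroupSchemes/*`).
set_option backward.isDefEq.respectTransparency false

noncomputable section

open CategoryTheory CategoryTheory.Limits AlgebraicGeometry MonoidalCategory CartesianMonoidalCategory

open scoped MonObj Obj

universe u

namespace Literature.AlgebraicGeometry.GroupSchemes.AdmIdealTransport

open Literature.AlgebraicGeometry.Motives AffineGroupScheme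
open GroupSchemeKernel (kerι)

variable {R : Type u} [CommRing R] {G G' : SchemeOver R}

/-! ## §1 The algebra isomorphism `Γ(φ) : Γ(G', 𝒪) ≅ Γ(G, 𝒪)` of an isomorphism `φ : G ≅ G'` and the transported ideal `Γ(φ)⁻¹(I)` -/

/-- `Γ(φ⁻¹) (Γ(φ) a') = a'` for an isomorphism `φ : G ≅ G'` of `R`-schemes (`Γ(φ⁻¹ ≫ φ) = Γ(φ) ≫ Γ(φ⁻¹)` and `φ⁻¹ ≫ φ = 𝟙`).
[cite: GortzWedhorn2023, §(27.2) (p. 606)] -/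
theorem appTop_inv_appTop_hom_apply (φ : G ≅ G') (a' : Alg G') :
    φ.inv.left.appTop.hom (φ.hom.left.appTop.hom a') = a' := by
  have h : (φ.inv ≫ φ.hom).left.appTop.hom a' = a' := by
    rw [φ.inv_hom_id]
    rfl
  rw [Over.comp_left, Scheme.Hom.comp_appTop] at h
  exact h

/-- `Γ(φ) (Γ(φ⁻¹) a) = a` for an isomorphism `φ : G ≅ G'` of `R`-schemes. [cite: GortzWedhorn2023, §(27.2) (p. 606)] -/
theorem appTop_hom_appTop_inv_apply (φ : G ≅ G') (a : Alg G) :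
    φ.hom.left.appTop.hom (φ.inv.left.appTop.hom a) = a := by
  have h : (φ.hom ≫ φ.inv).left.appTop.hom a = a := by
    rw [φ.hom_inv_id]
    rfl
  rw [Over.comp_left, Scheme.Hom.comp_appTop] at h
  exact h

/-- **`Γ(φ) : Alg G' ≃ₐ[R] Alg G`** for an isomorphism `φ : G ≅ G'` of `R`-schemes: an `R`-algebra isomorphism that IS `Γ(φ) = φ.hom.left.appTop`
on elements, with inverse `Γ(φ⁻¹)` (★ `Alg.comap`, `Alg.comap_comp`, `Alg.comap_id`). [cite: GortzWedhorn2023, §(27.2) (p. 606)] -/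
theorem exists_algEquiv_of_iso (φ : G ≅ G') :
    ∃ e : Alg G' ≃ₐ[R] Alg G, (∀ a', e a' = φ.hom.left.appTop.hom a') ∧ ∀ a, e.symm a = φ.inv.left.appTop.hom a := by
  refine ⟨AlgEquiv.ofAlgHom (Alg.comap φ.hom) (Alg.comap φ.inv) ?_ ?_, fun a' => rfl, fun a => rfl⟩
  · rw [← Alg.comap_comp, φ.hom_inv_id, Alg.comap_id]
  · rw [← Alg.comap_comp, φ.inv_hom_id, Alg.comap_id]

/-- MEMBERSHIP: `a' ∈ Γ(φ)⁻¹ I ↔ Γ(φ) a' ∈ I` (Mathlib `Ideal.mem_comap`, recorded in the `appTop` binder shape).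
[cite: GortzWedhorn2023, (27.1.1)] -/
theorem mem_comap_appTop_iff (φ : G ⟶ G') (I : Ideal (Alg G)) (a' : Alg G') :
    a' ∈ (I.comap φ.left.appTop.hom : Ideal (Alg G')) ↔ φ.left.appTop.hom a' ∈ I :=
  Ideal.mem_comap

/-- FUNCTORIALITY: `Γ(φ ≫ ψ)⁻¹(I) = Γ(ψ)⁻¹(Γ(φ)⁻¹(I))` for morphisms `φ : G ⟶ G'`, `ψ : G' ⟶ G''` — transport of ideals along the twisting maps
is compatible with composition (so `γ ↦ smap γ` is an action). [cite: GortzWedhorn2023, §(27.2) (p. 606)] -/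
theorem comap_appTop_comp {G'' : SchemeOver R} (φ : G ⟶ G') (ψ : G' ⟶ G'') (I : Ideal (Alg G)) :
    (I.comap (φ ≫ ψ).left.appTop.hom : Ideal (Alg G'')) = (I.comap φ.left.appTop.hom : Ideal (Alg G')).comap ψ.left.appTop.hom := by
  rw [Over.comp_left, Scheme.Hom.comp_appTop, CommRingCat.hom_comp, ← Ideal.comap_comap]

/-- `Γ(𝟙)⁻¹(I) = I`. [cite: GortzWedhorn2023, §(27.2) (p. 606)] -/
theorem comap_appTop_id (I : Ideal (Alg G)) : (I.comap (𝟙 G : G ⟶ G).left.appTop.hom : Ideal (Alg G)) = I := by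
  rw [Over.id_left, Scheme.Hom.id_appTop]
  exact Ideal.comap_id I

/-- BIJECTIVITY: `Γ(φ⁻¹)⁻¹ (Γ(φ)⁻¹ I) = I` — transporting along `φ` and back along `φ⁻¹` is the identity on ideals (with the symmetric
statement `comap_appTop_hom_comap_appTop_inv`, `I ↦ Γ(φ)⁻¹ I` is a bijection `Ideal (Alg G) ≃ Ideal (Alg G')`).
[cite: GortzWedhorn2023, (27.1.1) and §(27.2) (p. 607)] -/
theorem comap_appTop_inv_comap_appTop_hom (φ : G ≅ G') (I : Ideal (Alg G)) :
    ((I.comap φ.hom.left.appTop.hom : Ideal (Alg G')).comap φ.inv.left.appTop.hom : Ideal (Alg G)) = I := by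
  rw [← comap_appTop_comp, φ.hom_inv_id]
  exact comap_appTop_id I

/-- The same for `φ.symm`: `Γ(φ)⁻¹ (Γ(φ⁻¹)⁻¹ I') = I'`. [cite: GortzWedhorn2023, (27.1.1) and §(27.2) (p. 607)] -/
theorem comap_appTop_hom_comap_appTop_inv (φ : G ≅ G') (I' : Ideal (Alg G')) :
    ((I'.comap φ.inv.left.appTop.hom : Ideal (Alg G)).comap φ.hom.left.appTop.hom : Ideal (Alg G')) = I' := by
  rw [← comap_appTop_comp, φ.inv_hom_id]
  exact comap_appTop_id I'

/-- **`Γ(φ)⁻¹(I) = Γ(φ⁻¹)(I)`**: for an isomorphism `φ : G ≅ G'` the `comap` along `Γ(φ)` and the `map` along `Γ(φ⁻¹)` of an ideal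
`I ⊂ Γ(G, 𝒪)` agree (`a' = Γ(φ⁻¹)(Γ(φ) a')` one way, `Γ(φ⁻¹)⁻¹ (Γ(φ)⁻¹ I) = I` the other). [cite: GortzWedhorn2023, (27.1.1) and §(27.2) (p. 607)] -/
theorem comap_appTop_eq_map_appTop_inv (φ : G ≅ G') (I : Ideal (Alg G)) :
    (I.comap φ.hom.left.appTop.hom : Ideal (Alg G')) = I.map φ.inv.left.appTop.hom := by
  apply le_antisymm
  · intro a' ha'
    rw [Ideal.mem_comap] at ha'
    rw [← appTop_inv_appTop_hom_apply φ a']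
    exact Ideal.mem_map_of_mem _ ha'
  · rw [Ideal.map_le_iff_le_comap, comap_appTop_inv_comap_appTop_hom]

/-! ## §2 `Γ(φ)⁻¹(I)` is a Hopf ideal: it is the ideal of the closed subgroup scheme `Spec (Γ(G) ⧸ I) ↪ G ⥲ G'` -/

/-- `Γ(j ≫ φ)⁻¹`-bookkeeping: the kernel of `Γ(j ≫ φ) = Γ(j) ∘ Γ(φ)` is `Γ(φ)⁻¹ (ker Γ(j))` for any `j : K ⟶ G`, `φ : G ⟶ G'`.
[cite: GortzWedhorn2023, §(27.2) (p. 606)] -/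
theorem ker_appTop_comp_eq_comap {K : SchemeOver R} (j : K ⟶ G) (φ : G ⟶ G') :
    (RingHom.ker (j ≫ φ).left.appTop.hom : Ideal (Alg G')) =
      (RingHom.ker j.left.appTop.hom : Ideal (Alg G)).comap φ.left.appTop.hom := by
  rw [Over.comp_left, Scheme.Hom.comp_appTop, CommRingCat.hom_comp, RingHom.comap_ker]

/-- **HOPF IDEALS TRANSPORT**: for an isomorphism of affine group schemes `φ : G ⥲ G'` (`IsMonHom φ.hom`) and a Hopf ideal `I ⊂ Γ(G, 𝒪_G)`,
`Γ(φ)⁻¹(I) ⊂ Γ(G', 𝒪_{G'})` is a Hopf ideal: it is the ideal `ker Γ(quotIncl G I ≫ φ)` of the closed subgroup scheme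
`Spec (Γ(G) ⧸ I) ↪ G ⥲ G'` (★ `exists_grpObj_isMonHom_quotIncl`: `quotIncl` is a homomorphism for the induced group structure; ★
`isHopfIdeal_ker_appTop`; ★ `ker_appTop_quotIncl`). [cite: Waterhouse1979, §2.1] [cite: GortzWedhorn2023, (27.1.1) and §(27.2) (p. 607)] -/
theorem isHopfIdeal_comap_appTop [GrpObj G] [GrpObj G'] [IsAffine G.left] [IsAffine G'.left] (φ : G ≅ G') [IsMonHom φ.hom]
    (I : Ideal (Alg G)) [I.IsHopfIdeal R] :
    (I.comap φ.hom.left.appTop.hom : Ideal (Alg G')).IsHopfIdeal R := by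
  haveI : IsAffine (Motives.specOver R (Alg G ⧸ I)).left := inferInstanceAs (IsAffine (Spec (CommRingCat.of (Alg G ⧸ I))))
  obtain ⟨GZ, hmon⟩ := exists_grpObj_isMonHom_quotIncl G I
  letI := GZ
  haveI := hmon
  haveI : IsClosedImmersion (quotIncl G I).left := isClosedImmersion_quotIncl_left G I
  haveI : IsClosedImmersion (quotIncl G I ≫ φ.hom).left := by
    rw [Over.comp_left]
    infer_instance
  have h := isHopfIdeal_ker_appTop (quotIncl G I ≫ φ.hom)
  rw [ker_appTop_comp_eq_comap, ker_appTop_quotIncl] at h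
  exact h

/-! ## §3 The order: `Γ(G') ⧸ Γ(φ)⁻¹(I) ≅ Γ(G) ⧸ I` -/

/-- **`Γ(G') ⧸ Γ(φ)⁻¹(I) ≃ₐ[R] Γ(G) ⧸ I`** along `Γ(φ)` (Mathlib `Ideal.quotientEquivAlg`; `Γ(φ)(Γ(φ)⁻¹ I) = I` as `Γ(φ)` is onto).
[cite: GortzWedhorn2023, (27.1.1) and §(27.2) (p. 607)] -/
theorem exists_algEquiv_quotient_comap_appTop (φ : G ≅ G') (I : Ideal (Alg G)) :
    ∃ e : (Alg G' ⧸ (I.comap φ.hom.left.appTop.hom : Ideal (Alg G'))) ≃ₐ[R] Alg G ⧸ I,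
      ∀ a', e (Ideal.Quotient.mk _ a') = Ideal.Quotient.mk I (φ.hom.left.appTop.hom a') := by
  obtain ⟨e, he, -⟩ := exists_algEquiv_of_iso φ
  have hφe : (I.comap φ.hom.left.appTop.hom : Ideal (Alg G')) = I.comap (e : Alg G' →+* Alg G) := by
    ext a'
    simp only [Ideal.mem_comap]
    exact Iff.of_eq (congrArg (· ∈ I) (he a').symm)
  have hIJ : I = Ideal.map (e : Alg G' →+* Alg G) (I.comap φ.hom.left.appTop.hom : Ideal (Alg G')) := by
    rw [hφe, Ideal.map_comap_of_surjective (e : Alg G' →+* Alg G) (fun b => ⟨e.symm b, e.apply_symm_apply b⟩)]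
  refine ⟨Ideal.quotientEquivAlg (I.comap φ.hom.left.appTop.hom : Ideal (Alg G')) I e hIJ, fun a' => ?_⟩
  rw [← he a']
  rfl

/-- **THE ORDER IS PRESERVED**: `rank_R (Γ(G') ⧸ Γ(φ)⁻¹ I) = rank_R (Γ(G) ⧸ I)` (the order of the transported subgroup scheme `φ(H)` is
the order of `H`). [cite: Tate1997FiniteFlatGroupSchemes, (3.7)] [cite: GortzWedhorn2023, (27.1.1)] -/
theorem finrank_quotient_comap_appTop (φ : G ≅ G') (I : Ideal (Alg G)) :
    Module.finrank R (Alg G' ⧸ (I.comap φ.hom.left.appTop.hom : Ideal (Alg G'))) = Module.finrank R (Alg G ⧸ I) := by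
  obtain ⟨e, -⟩ := exists_algEquiv_quotient_comap_appTop φ I
  exact e.toLinearEquiv.finrank_eq

/-! ## §4 Stability under intertwined endomorphisms; the admissible triple -/

/-- **STABILITY TRANSPORTS** (any morphism `φ`, no group structure needed): if `b ≫ φ = φ ≫ b'` and `Γ(b)(I) ⊆ I`, then
`Γ(b')(Γ(φ)⁻¹ I) ⊆ Γ(φ)⁻¹ I` — for `a'` with `Γ(φ) a' ∈ I`, `Γ(φ)(Γ(b') a') = Γ(φ ≫ b') a' = Γ(b ≫ φ) a' = Γ(b)(Γ(φ) a') ∈ I`.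
[cite: GortzWedhorn2023, §(27.2) (p. 606)] -/
theorem map_le_comap_appTop_of_comm (φ : G ⟶ G') (b : G ⟶ G) (b' : G' ⟶ G') (hcomm : b ≫ φ = φ ≫ b') (I : Ideal (Alg G))
    (hI : I.map b.left.appTop.hom ≤ I) :
    (I.comap φ.left.appTop.hom : Ideal (Alg G')).map b'.left.appTop.hom ≤ (I.comap φ.left.appTop.hom : Ideal (Alg G')) := by
  rw [Ideal.map_le_iff_le_comap]
  intro a' ha'
  rw [Ideal.mem_comap] at ha'
  have h : φ.left.appTop.hom (b'.left.appTop.hom a') = b.left.appTop.hom (φ.left.appTop.hom a') := by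
    have h1 : (φ ≫ b').left.appTop.hom a' = (b ≫ φ).left.appTop.hom a' := by rw [hcomm]
    rw [Over.comp_left, Over.comp_left, Scheme.Hom.comp_appTop, Scheme.Hom.comp_appTop] at h1
    exact h1
  have hmem : b.left.appTop.hom (φ.left.appTop.hom a') ∈ I := hI (Ideal.mem_map_of_mem _ ha')
  rw [Ideal.mem_comap, Ideal.mem_comap]
  change φ.left.appTop.hom (b'.left.appTop.hom a') ∈ I
  rw [h]
  exact hmem

/-- **THE ADMISSIBLE TRIPLE TRANSPORTS** (`hsmapAdm` of the DICT-constructor head with `IsAdm` unfolded): for an isomorphism of affine group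
schemes `φ : G ⥲ G'` intertwining two families of endomorphisms (`β a ≫ φ = φ ≫ β' a`), if `I` is a Hopf ideal of colength `r` stable under every
`Γ(β a)`, then `Γ(φ)⁻¹ I` is a Hopf ideal of colength `r` stable under every `Γ(β' a)` (§2 + §3 + `map_le_comap_appTop_of_comm`).
[cite: Tate1997FiniteFlatGroupSchemes, (3.7)] [cite: Waterhouse1979, §2.1] [cite: GortzWedhorn2023, (27.1.1) and §(27.2) (p. 607)] -/
theorem isHopfIdeal_and_finrank_and_map_le_comap_appTop [GrpObj G] [GrpObj G'] [IsAffine G.left] [IsAffine G'.left]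
    (φ : G ≅ G') [IsMonHom φ.hom] {σ : Type*} (β : σ → (G ⟶ G)) (β' : σ → (G' ⟶ G')) (hββ' : ∀ a, β a ≫ φ.hom = φ.hom ≫ β' a)
    {r : ℕ} {I : Ideal (Alg G)} (hI : I.IsHopfIdeal R ∧ Module.finrank R (Alg G ⧸ I) = r ∧ ∀ a, I.map (β a).left.appTop.hom ≤ I) :
    (I.comap φ.hom.left.appTop.hom : Ideal (Alg G')).IsHopfIdeal R ∧
      Module.finrank R (Alg G' ⧸ (I.comap φ.hom.left.appTop.hom : Ideal (Alg G'))) = r ∧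
      ∀ a, (I.comap φ.hom.left.appTop.hom : Ideal (Alg G')).map (β' a).left.appTop.hom ≤
        (I.comap φ.hom.left.appTop.hom : Ideal (Alg G')) := by
  obtain ⟨hH, hr, hst⟩ := hI
  haveI := hH
  exact ⟨isHopfIdeal_comap_appTop φ I, (finrank_quotient_comap_appTop φ I).trans hr,
    fun a => map_le_comap_appTop_of_comm φ.hom (β a) (β' a) (hββ' a) I (hst a)⟩

/-! ## §5 The Frobenius-kernel ideal transports to the Frobenius-kernel ideal -/

section Frobenius

variable {k : Type u} [Field k] (p : ℕ) [ExpChar k p] (n : ℕ) {G G' : SchemeOver k} [GrpObj G] [GrpObj G']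

/-- **`Γ(φ)⁻¹ (ker Γ(ι_{Ker F^n_G})) = ker Γ(ι_{Ker F^n_{G'}})`** for an isomorphism of `k`-group schemes `φ : G ⥲ G'` — the transported
Frobenius kernel is the Frobenius kernel (`hsmapF` of the DICT-constructor head with `kerFI` unfolded).  `⊇`: functoriality of `F^n` in the
homomorphism `φ` (★ `ker_appTop_kerι_relFrobeniusOver_le_comap`); `⊆`: the same for `φ⁻¹` (★ `map_ker_appTop_kerι_relFrobeniusOver_le`), using
`a' = Γ(φ⁻¹)(Γ(φ) a')`. [cite: SGA3I, VII_A 4.1] [cite: GortzWedhorn2020, Definition 4.45 (2) (p. 117)] -/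
theorem comap_appTop_ker_kerι_relFrobeniusOver (φ : G ≅ G') [IsMonHom φ.hom] :
    ((RingHom.ker (kerι (relFrobeniusOver p n G)).left.appTop.hom : Ideal (Alg G)).comap φ.hom.left.appTop.hom : Ideal (Alg G')) =
      (RingHom.ker (kerι (relFrobeniusOver p n G')).left.appTop.hom : Ideal (Alg G')) := by
  apply le_antisymm
  · intro a' ha'
    rw [Ideal.mem_comap] at ha'
    have h := map_ker_appTop_kerι_relFrobeniusOver_le p n φ.inv (Ideal.mem_map_of_mem φ.inv.left.appTop.hom ha')
    rw [← appTop_inv_appTop_hom_apply φ a']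
    exact h
  · exact ker_appTop_kerι_relFrobeniusOver_le_comap p n φ.hom

/-- The `map` form: **`Γ(φ⁻¹) (ker Γ(ι_{Ker F^n_G})) = ker Γ(ι_{Ker F^n_{G'}})`**. [cite: SGA3I, VII_A 4.1]
[cite: GortzWedhorn2020, Definition 4.45 (2) (p. 117)] -/
theorem map_appTop_inv_ker_kerι_relFrobeniusOver (φ : G ≅ G') [IsMonHom φ.hom] :
    ((RingHom.ker (kerι (relFrobeniusOver p n G)).left.appTop.hom : Ideal (Alg G)).map φ.inv.left.appTop.hom : Ideal (Alg G')) =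
      (RingHom.ker (kerι (relFrobeniusOver p n G')).left.appTop.hom : Ideal (Alg G')) := by
  rw [← comap_appTop_eq_map_appTop_inv]
  exact comap_appTop_ker_kerι_relFrobeniusOver p n φ

end Frobenius

/-! ## §6 Étaleness of the subgroup scheme an ideal cuts out is preserved -/

/-- `Spec B → Spec R` is étale iff `Spec A → Spec R` is, for `R`-algebras `A ≃ₐ[R] B` (`Spec B ⥲ Spec A` over `Spec R`; Mathlib `Etale` respects
isomorphisms). [cite: GortzWedhorn2020, Section (4.7)] -/
theorem etale_specOver_iff_of_algEquiv {A B : Type u} [CommRing A] [Algebra R A] [CommRing B] [Algebra R B] (e : A ≃ₐ[R] B) :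
    Etale (Motives.specOver R B).hom ↔ Etale (Motives.specOver R A).hom := by
  have hfac : (Motives.specOver R B).hom = Spec.map (CommRingCat.ofHom (e : A →+* B)) ≫ (Motives.specOver R A).hom := by
    change Spec.map (CommRingCat.ofHom (algebraMap R B)) =
      Spec.map (CommRingCat.ofHom (e : A →+* B)) ≫ Spec.map (CommRingCat.ofHom (algebraMap R A))
    rw [← Spec.map_comp, ← CommRingCat.ofHom_comp]
    congr 2
    ext r
    exact (e.commutes r).symm
  haveI : IsIso (CommRingCat.ofHom (e : A →+* B)) :=
    ⟨⟨CommRingCat.ofHom (e.symm : B →+* A), by ext x; exact e.symm_apply_apply x, by ext x; exact e.apply_symm_apply x⟩⟩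
  rw [hfac]
  exact MorphismProperty.cancel_left_of_respectsIso @Etale _ _

/-- **ÉTALENESS TRANSPORTS** (`isEtale_smap_iff` of P6a's `ModuliDatum` with `IdealIsEtale` unfolded): `Spec (Γ(G') ⧸ Γ(φ)⁻¹ I) → Spec R` is
étale iff `Spec (Γ(G) ⧸ I) → Spec R` is (the two are isomorphic over `Spec R`, §3). [cite: Tate1997FiniteFlatGroupSchemes, (3.7)]
[cite: GortzWedhorn2020, Section (4.7)] -/
theorem etale_specOver_quotient_comap_appTop_iff (φ : G ≅ G') (I : Ideal (Alg G)) :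
    Etale (Motives.specOver R (Alg G' ⧸ (I.comap φ.hom.left.appTop.hom : Ideal (Alg G')))).hom ↔
      Etale (Motives.specOver R (Alg G ⧸ I)).hom := by
  obtain ⟨e, -⟩ := exists_algEquiv_quotient_comap_appTop φ I
  exact (etale_specOver_iff_of_algEquiv e).symm

end Literature.AlgebraicGeometry.GroupSchemes.AdmIdealTransport

end
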